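import Summits.AtomisticToContinuum.FouriersLaw.Theses.OddSectorIrreversibility
import Summits.AtomisticToContinuum.FouriersLaw.Theorems.PhononMeanFreePathBoundaryKubo

/-!
# Stub `stub_cornerKubo` of line `ohmic-floor-monotone-ladder`
# (crux stmt-AtomisticToContinuum-9141, `OddSectorIrreversibility.BoundedResponseConverges`) — PROVED

**The corner (cross-form) Green–Kubo formula, as the line's fixed-`N` stub.** For the pinned anharmonic chain
`pinnedChain ω₂ lam β γ` (all parameters `> 0`) between Langevin baths, under weak-NESS uniqueness, along every
steady-state family `μ`, at every `T > 0` and for every `N` (chain of `N+1` sites `0, …, N`):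
(a) the equilibrium corner covariance `t ↦ C_N(t) = Cov_{μ_T}(p_0², K_t p_N²)` (`μ_T` the Gibbs measure,
`K_t` the constructed equal-temperature transition kernels; in tree `kuboIntegrand ω₂ lam β γ T N t`) is integrable
on `(0, ∞)`, and (b) EVERY clause-(ii) response coefficient `d = lim_{δ → 0, δ ≠ 0} totalCurrent(μ (N+1) (T+δ/2) (T−δ/2))/δ`
of the `(N+1)`-chain equals the Kubo value `kuboValue ω₂ lam β γ T N = N·(γ²/T²)·∫₀^∞ C_N`.

This is the registered stub `stub_cornerKubo` of the reshaped skeleton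
`Cruxes/BoundedResponseConverges/Lines/ohmic-floor-monotone-ladder.lean` (lead c2, 2026-08-16), verbatim. After the
landing of the sibling crux `PhononMeanFreePath.BoundaryKubo` (stmt-AtomisticToContinuum-11812,
`PhononMeanFreePathBoundaryKubo.boundaryKubo_proof`, line gibbs-ttcf: Gibbs-tested transient time-correlation identity,
Harris bounds locally uniform in the bath temperatures, energy balance, equilibrium sum rule) it is a COROLLARY:
`boundaryKubo_proof` gives (a) and the convergence of the response quotient to `kuboValue`; limits along the proper
filter `𝓝[≠] 0` are unique.

References: Kundu–Dhar–Narayan, J. Stat. Mech. (2009) L03001 (arXiv:0809.4543); Rey-Bellet 2003, Rem. 4.4;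
Bonetto–Lebowitz–Rey-Bellet 2000 §5.2 (32); Cuneo–Eckmann–Hairer–Rey-Bellet 2018, Thm 2.13.
No definitions, no named facts; standard axioms.
-/

noncomputable section

open MeasureTheory Filter Topology Set

namespace Summit.AtomisticToContinuum.FouriersLaw.Cruxes.BoundedResponseConverges.OhmicFloorMonotoneLadder.Stubs

open Literature.MathematicalPhysics.KineticTheory.HeatConduction
open Summit.AtomisticToContinuum.FouriersLaw.Theorems.BoundaryKubo.Negative.LoadBearing (kuboIntegrand kuboValue)

/-- **Stub `stub_cornerKubo` (corner Green–Kubo formula), proved.** Under weak-NESS uniqueness, along every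
steady-state family of `pinnedChain ω₂ lam β γ` (all `> 0`), for every `T > 0` and every `N`: the corner covariance
`kuboIntegrand ω₂ lam β γ T N` of the `(N+1)`-chain is integrable on `(0,∞)`, and every clause-(ii) response
coefficient `d` of the `(N+1)`-chain equals `kuboValue ω₂ lam β γ T N = N·(γ²/T²)·∫₀^∞ kuboIntegrand`. Corollary of
the landed `boundaryKubo_proof` (crux stmt-11812) and uniqueness of limits along `𝓝[≠] 0`.
[cite: KunduDharNarayan2009, arXiv:0809.4543 p. 3] [cite: CuneoEckmannHairerReyBellet2018, Thm 2.13] -/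
theorem stub_cornerKubo :
    ∀ ω₂ lam β γ : ℝ, 0 < ω₂ → 0 < lam → 0 < β → 0 < γ →
      (∀ (N : ℕ) (T_L T_R : ℝ), 0 < T_L → 0 < T_R → ∀ μ ν : Measure (PhaseSpace N),
        (pinnedChain ω₂ lam β γ).IsSteadyState N T_L T_R μ →
        (pinnedChain ω₂ lam β γ).IsSteadyState N T_L T_R ν → μ = ν) →
      ∀ μ : (N : ℕ) → ℝ → ℝ → Measure (PhaseSpace N),
        (∀ (N : ℕ) (T_L T_R : ℝ), 0 < T_L → 0 < T_R →
          (pinnedChain ω₂ lam β γ).IsSteadyState N T_L T_R (μ N T_L T_R)) →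
      ∀ T : ℝ, 0 < T → ∀ N : ℕ,
        IntegrableOn (kuboIntegrand ω₂ lam β γ T N) (Set.Ioi 0) ∧
        ∀ d : ℝ, Tendsto (fun δ : ℝ =>
            (pinnedChain ω₂ lam β γ).totalCurrent (μ (N + 1) (T + δ / 2) (T - δ / 2)) / δ) (𝓝[≠] 0) (𝓝 d) →
          d = kuboValue ω₂ lam β γ T N := by
  intro ω₂ lam β γ hω hl hβ hγ hU μ hμ T hT N
  obtain ⟨hint, hlim⟩ :=
    Summit.AtomisticToContinuum.FouriersLaw.Theorems.PhononMeanFreePathBoundaryKubo.boundaryKubo_proof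
      ω₂ lam β γ hω hl hβ hγ hU μ hμ T hT N
  exact ⟨hint, fun d hd => tendsto_nhds_unique hd hlim⟩

/-- **The response sequence of the crux IS the Kubo value sequence, shifted by one** (the form the line's
composition consumes): under the crux's frame, every sequence `D` of clause-(ii) response coefficients satisfies
`D (N+1) = kuboValue ω₂ lam β γ T N` for all `N` (and `D 0 = 0`, the empty chain carrying no current).
[cite: KunduDharNarayan2009, arXiv:0809.4543 p. 3] -/
theorem response_succ_eq_kuboValue {ω₂ lam β γ : ℝ} (hω : 0 < ω₂) (hl : 0 < lam) (hβ : 0 < β) (hγ : 0 < γ)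
    (hU : ∀ (N : ℕ) (T_L T_R : ℝ), 0 < T_L → 0 < T_R → ∀ μ ν : Measure (PhaseSpace N),
        (pinnedChain ω₂ lam β γ).IsSteadyState N T_L T_R μ →
        (pinnedChain ω₂ lam β γ).IsSteadyState N T_L T_R ν → μ = ν)
    {μ : (N : ℕ) → ℝ → ℝ → Measure (PhaseSpace N)}
    (hμ : ∀ (N : ℕ) (T_L T_R : ℝ), 0 < T_L → 0 < T_R →
          (pinnedChain ω₂ lam β γ).IsSteadyState N T_L T_R (μ N T_L T_R))
    {T : ℝ} (hT : 0 < T) {D : ℕ → ℝ}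
    (hD : ∀ N : ℕ, Tendsto (fun δ : ℝ =>
        (pinnedChain ω₂ lam β γ).totalCurrent (μ N (T + δ / 2) (T - δ / 2)) / δ) (𝓝[≠] 0) (𝓝 (D N))) :
    (∀ N : ℕ, D (N + 1) = kuboValue ω₂ lam β γ T N) ∧ D 0 = 0 := by
  refine ⟨fun N => (stub_cornerKubo ω₂ lam β γ hω hl hβ hγ hU μ hμ T hT N).2 (D (N + 1)) (hD (N + 1)), ?_⟩
  -- the empty chain: `totalCurrent ≡ 0`, so the quotient is identically `0`
  have h0 : Tendsto (fun δ : ℝ =>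
      (pinnedChain ω₂ lam β γ).totalCurrent (μ 0 (T + δ / 2) (T - δ / 2)) / δ) (𝓝[≠] 0) (𝓝 0) := by
    refine (tendsto_const_nhds (x := (0 : ℝ))).congr' ?_
    filter_upwards with δ
    simp [OscillatorChain.totalCurrent_zero]
  exact tendsto_nhds_unique (hD 0) h0

end Summit.AtomisticToContinuum.FouriersLaw.Cruxes.BoundedResponseConverges.OhmicFloorMonotoneLadder.Stubs

end
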